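import Mathlib.Geometry.Manifold.VectorBundle.Riemannian
import Mathlib.Geometry.Manifold.VectorBundle.ContMDiffSection
import Mathlib.Topology.VectorBundle.FiniteDimensional
import Mathlib.LinearAlgebra.QuadraticForm.Signature
import Mathlib.LinearAlgebra.BilinearForm.Properties
import Mathlib.LinearAlgebra.Trace
import HarnessLib

-- provenance: harness21/H21/H21/Prelude/Lorentz/PseudoRiemannianMetric.lean @ dbe5a04 (interim HEAD d8f2665); M5 mechanical rewrite
/-!
# Pseudo-Riemannian metrics on vector bundles (trunk G08 = T-LORENTZ, item C1)

A `C^n` pseudo-Riemannian metric on a real vector bundle `E → B` over a `C^n` manifold `B` is a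
family of symmetric *nondegenerate* bilinear forms `g_b` on the fibres `E b`, depending `C^n` on
the base point in the sense that `b ↦ g_b` is a `C^n` section of the bundle of bilinear forms
`Hom(E, Hom(E, ℝ))`. This is the bundle-level notion underlying Lorentzian metrics
(notion `lorentzian_metric_time_orientation`, first half); the tangent-bundle specialisation with
signature `(−,+,…,+)` is `Literature.Geometry.Lorentzian.LorentzianMetric` (file `LorentzianMetric.lean`).

## Mathlib

Mathlib has the positive-definite version `Bundle.ContMDiffRiemannianMetric IB n F E`
(`Mathlib/Geometry/Manifold/VectorBundle/Riemannian.lean`) with fields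
`inner/symm/pos/isVonNBounded/contMDiff`; there is no pseudo-Riemannian or Lorentzian metric in
Mathlib (`rg -i 'lorentz|pseudoriemann' Mathlib/Geometry` is empty). The structure below is a
verbatim sibling of `Bundle.ContMDiffRiemannianMetric` with the same variable block (minus the
fibrewise `IsTopologicalAddGroup`/`ContinuousConstSMul` hypotheses, which nothing here uses), in
which `pos` and `isVonNBounded` are replaced by `nondegenerate`. The bridge from the Riemannian case is
`PseudoRiemannianMetric.ofRiemannian`. The pointwise linear algebra uses Mathlib's
`ContinuousLinearMap.toLinearMap₁₂`, `LinearMap.BilinForm.Nondegenerate`,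
`LinearMap.BilinForm.toDual`, `sigNeg` (index of a quadratic form) and `LinearMap.trace`.

## Design choices

* Regularity `n : ℕ∞ω` and the model `IB` of the base are parameters, exactly as in Mathlib.
* No global `FiniteDimensional ℝ (E b)` instance is registered (it would loop / create diamonds on
  `TangentSpace`); the musical isomorphism `sharp`, `trace`, `normSq` and `innerDual` assume
  `[FiniteDimensional ℝ F]` and obtain finite-dimensionality of the fibre *inside* the definition
  from the Mathlib lemma `VectorBundle.finiteDimensional`.
* `index g b` is the negative index of inertia of `g_b` (so a Lorentzian metric in signature
  `(−,+,…,+)` has index `1`, O'Neill's convention).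

## References

* B. O'Neill, *Semi-Riemannian geometry with applications to relativity*, Academic Press 1983,
  Chapter 3 (Definition 3.1: metric tensor; Lemma 3.19 ff.: index; pp. 60–61: musical
  isomorphisms and metric contraction).
-/

open Manifold Bundle
open scoped ContDiff Topology

noncomputable section

namespace Literature.Geometry.Lorentzian

variable
  {EB : Type*} [NormedAddCommGroup EB] [NormedSpace ℝ EB]
  {HB : Type*} [TopologicalSpace HB] {IB : ModelWithCorners ℝ EB HB} {n n' : ℕ∞ω}
  {B : Type*} [TopologicalSpace B] [ChartedSpace HB B]
  {F : Type*} [NormedAddCommGroup F] [NormedSpace ℝ F]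
  {E : B → Type*} [TopologicalSpace (TotalSpace F E)]
  [∀ b, TopologicalSpace (E b)] [∀ b, AddCommGroup (E b)] [∀ b, Module ℝ (E b)]
  [FiberBundle F E] [VectorBundle ℝ F E]

variable (IB n F E) in
/-- A `C^n` **pseudo-Riemannian metric** on a real vector bundle `E → B` with model fibre `F` over a
manifold `B` modelled on `IB`: a family of continuous bilinear forms `val b` on the fibres `E b`
which are symmetric and nondegenerate (`val b v w = 0` for all `w` forces `v = 0`), and such that
`b ↦ val b` is a `C^n` section of the bundle `Hom(E, Hom(E, ℝ))`. This is the sibling of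
`Bundle.ContMDiffRiemannianMetric IB n F E` with positivity replaced by nondegeneracy.
O'Neill 1983, Ch. 3, Definition 3.1. [cite: ONeill1983, Ch. 3  Definition 3.1] -/
@[ext]
structure PseudoRiemannianMetric where
  /-- The scalar product along the fibres of the bundle. -/
  val (b : B) : E b →L[ℝ] E b →L[ℝ] ℝ
  /-- The scalar product is symmetric. -/
  symm (b : B) (v w : E b) : val b v w = val b w v
  /-- The scalar product is nondegenerate on every fibre. -/
  nondegenerate (b : B) (v : E b) (hv : ∀ w, val b v w = 0) : v = 0
  /-- The scalar product is a `C^n` section of the bundle of bilinear forms. -/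
  contMDiff : ContMDiff IB (IB.prod 𝓘(ℝ, F →L[ℝ] F →L[ℝ] ℝ)) n
    (fun b ↦ TotalSpace.mk' (F →L[ℝ] F →L[ℝ] ℝ) b (val b))

namespace PseudoRiemannianMetric

/-! ### Pointwise linear algebra -/

/-- The metric at `b` as an algebraic bilinear form `LinearMap.BilinForm ℝ (E b)` (forgetting
continuity), via `ContinuousLinearMap.toLinearMap₁₂`. O'Neill 1983, Ch. 3, Def. 3.1. [cite: ONeill1983, Ch. 3  Def. 3.1] -/
def toBilinForm (g : PseudoRiemannianMetric IB n F E) (b : B) : LinearMap.BilinForm ℝ (E b) :=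
  (g.val b).toLinearMap₁₂

/-- `toBilinForm` unfolds to `val`. [folklore] -/
@[simp]
lemma toBilinForm_apply (g : PseudoRiemannianMetric IB n F E) (b : B) (v w : E b) :
    g.toBilinForm b v w = g.val b v w := rfl

/-- The quadratic form `v ↦ g_b(v, v)` of the metric at `b` (O'Neill's `q`, Ch. 3, p. 55). [folklore] -/
def toQuadraticForm (g : PseudoRiemannianMetric IB n F E) (b : B) : QuadraticForm ℝ (E b) :=
  (g.toBilinForm b).toQuadraticMap

/-- `toQuadraticForm` unfolds to `val b v v`. [folklore] -/
@[simp]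
lemma toQuadraticForm_apply (g : PseudoRiemannianMetric IB n F E) (b : B) (v : E b) :
    g.toQuadraticForm b v = g.val b v v := rfl

/-- The bilinear form of the metric at `b` is symmetric. O'Neill 1983, Ch. 3, Def. 3.1. [cite: ONeill1983, Ch. 3  Def. 3.1] -/
lemma isSymm_toBilinForm (g : PseudoRiemannianMetric IB n F E) (b : B) :
    (g.toBilinForm b).IsSymm :=
  ⟨fun v w ↦ g.symm b v w⟩

/-- The bilinear form of the metric at `b` is nondegenerate (left- and right-separating).
O'Neill 1983, Ch. 3, Def. 3.1. [cite: ONeill1983, Ch. 3  Def. 3.1] -/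
lemma nondegenerate_toBilinForm (g : PseudoRiemannianMetric IB n F E) (b : B) :
    (g.toBilinForm b).Nondegenerate :=
  ⟨fun v hv ↦ g.nondegenerate b v hv,
    fun w hw ↦ g.nondegenerate b w fun v ↦ (g.symm b w v).trans (hw v)⟩

/-- The **index** of the metric at `b`: the negative index of inertia of `g_b`, i.e. the maximal
dimension of a subspace of `E b` on which `g_b` is negative definite (Mathlib's `sigNeg`). A
Lorentzian metric of signature `(−,+,…,+)` has index `1`. O'Neill 1983, Ch. 3, p. 55 and
Lemma 2.26. [cite: ONeill1983, Ch. 3  p. 55 and Lemma 2.26] -/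
def index (g : PseudoRiemannianMetric IB n F E) (b : B) : ℕ :=
  sigNeg (g.toQuadraticForm b)

/-- The musical isomorphism `♭` at `b` (index lowering): `v ↦ g_b(v, ·)`, as a linear map
`E b →ₗ[ℝ] Module.Dual ℝ (E b)`. It is injective by nondegeneracy and bijective on
finite-dimensional fibres (see `sharp`). O'Neill 1983, Ch. 3, p. 60. [cite: ONeill1983, Ch. 3  p. 60] -/
def flat (g : PseudoRiemannianMetric IB n F E) (b : B) : E b →ₗ[ℝ] Module.Dual ℝ (E b) :=
  g.toBilinForm b

/-- `♭ v = g_b(v, ·)`. O'Neill 1983, Ch. 3, p. 60. [cite: ONeill1983, Ch. 3  p. 60] -/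
@[simp]
lemma flat_apply (g : PseudoRiemannianMetric IB n F E) (b : B) (v w : E b) :
    g.flat b v w = g.val b v w := rfl

/-- `♭` is injective (nondegeneracy). O'Neill 1983, Ch. 3, p. 60. [cite: ONeill1983, Ch. 3  p. 60] -/
lemma flat_injective (g : PseudoRiemannianMetric IB n F E) (b : B) :
    Function.Injective (g.flat b) :=
  LinearMap.ker_eq_bot.mp (g.nondegenerate_toBilinForm b).ker_eq_bot

/-- A pseudo-Riemannian metric is **Riemannian** if it is positive definite on every fibre.
O'Neill 1983, Ch. 3, p. 55 (index `0`). [cite: ONeill1983, Ch. 3  p. 55 (index  0] -/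
def IsRiemannian (g : PseudoRiemannianMetric IB n F E) : Prop :=
  ∀ (b : B) (v : E b), v ≠ 0 → 0 < g.val b v v

/-! ### Change of regularity, negation -/

/-- A `C^n` pseudo-Riemannian metric is in particular `C^{n'}` for `n' ≤ n`. Mirrors
`Bundle.IsContMDiffRiemannianBundle.of_le`. [folklore] -/
def ofLE (g : PseudoRiemannianMetric IB n F E) (h : n' ≤ n) : PseudoRiemannianMetric IB n' F E where
  val := g.val
  symm := g.symm
  nondegenerate := g.nondegenerate
  contMDiff := g.contMDiff.of_le h

/-- `ofLE` does not change the metric. [folklore] -/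
@[simp]
lemma val_ofLE (g : PseudoRiemannianMetric IB n F E) (h : n' ≤ n) : (g.ofLE h).val = g.val := rfl

/-- The negative `-g` of a pseudo-Riemannian metric (swaps signatures `(p, q) ↔ (q, p)`; used to
pass between the `(−,+,…,+)` and `(+,−,…,−)` conventions). O'Neill 1983, Ch. 3, p. 55;
smoothness by `ContMDiff.neg_section`. [cite: ONeill1983, Ch. 3  p. 55] -/
def neg (g : PseudoRiemannianMetric IB n F E) : PseudoRiemannianMetric IB n F E where
  val b := -g.val b
  symm b v w := by simp [g.symm b v w]
  nondegenerate b v hv := g.nondegenerate b v fun w ↦ by simpa using hv w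
  contMDiff := g.contMDiff.neg_section

/-- The value of `-g`. [folklore] -/
@[simp]
lemma val_neg (g : PseudoRiemannianMetric IB n F E) (b : B) : g.neg.val b = -g.val b := rfl

/-- The index of `-g` is the positive index of inertia of `g`. O'Neill 1983, Ch. 3, p. 55. [cite: ONeill1983, Ch. 3  p. 55] -/
def index_neg : Prop :=
  ∀ (g : PseudoRiemannianMetric IB n F E) (b : B),
    g.neg.index b = sigPos (g.toQuadraticForm b)

/-! ### The Riemannian case -/

/-- A `C^n` Riemannian metric in Mathlib's sense (`Bundle.ContMDiffRiemannianMetric`) is a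
pseudo-Riemannian metric: positivity implies nondegeneracy. O'Neill 1983, Ch. 3, p. 55. [cite: ONeill1983, Ch. 3  p. 55] -/
def ofRiemannian (g : ContMDiffRiemannianMetric IB n F E) : PseudoRiemannianMetric IB n F E where
  val := g.inner
  symm := g.symm
  nondegenerate b v hv := by
    by_contra h
    exact (g.pos b v h).ne' (hv v)
  contMDiff := g.contMDiff

/-- `ofRiemannian` does not change the scalar product. [folklore] -/
@[simp]
lemma val_ofRiemannian (g : ContMDiffRiemannianMetric IB n F E) :
    (ofRiemannian g).val = g.inner := rfl

/-- The pseudo-Riemannian metric of a Riemannian metric is Riemannian. [folklore] -/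
lemma isRiemannian_ofRiemannian (g : ContMDiffRiemannianMetric IB n F E) :
    (ofRiemannian g).IsRiemannian :=
  fun b v hv ↦ g.pos b v hv

/-- A Riemannian metric has index `0` at every point. O'Neill 1983, Ch. 3, p. 55. [cite: ONeill1983, Ch. 3  p. 55] -/
def index_eq_zero_of_isRiemannian : Prop :=
  ∀ (g : PseudoRiemannianMetric IB n F E) (hg : g.IsRiemannian) (b : B),
    g.index b = 0

/-- The pseudo-Riemannian metric of a Mathlib Riemannian metric has index `0`.
O'Neill 1983, Ch. 3, p. 55. [cite: ONeill1983, Ch. 3  p. 55] -/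
def index_ofRiemannian : Prop :=
  ∀ (g : ContMDiffRiemannianMetric IB n F E) (b : B),
    (ofRiemannian g).index b = 0

/- interim proof relied on results that are now named facts (D-0014); demoted to a fact by the M5 import, proof preserved:
:=
  (ofRiemannian g).index_eq_zero_of_isRiemannian (isRiemannian_ofRiemannian g) b
-/

/-! ### Musical isomorphisms and metric contractions (finite-dimensional fibres) -/

section FiniteDimensional

variable [FiniteDimensional ℝ F]

/-- The musical isomorphism `♯` at `b` (index raising): the inverse of `♭ : v ↦ g_b(v, ·)`, a
linear equivalence `Module.Dual ℝ (E b) ≃ₗ[ℝ] E b`, characterised by `g_b(♯α, w) = α w`. Requires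
finite-dimensional fibres (obtained from `[FiniteDimensional ℝ F]` via
`VectorBundle.finiteDimensional`); it is `(LinearMap.BilinForm.toDual _ _).symm`.
O'Neill 1983, Ch. 3, p. 60 (metrically equivalent vectors and covectors). [cite: ONeill1983, Ch. 3  p. 60 (metrically equivalent vect] -/
def sharp (g : PseudoRiemannianMetric IB n F E) (b : B) : Module.Dual ℝ (E b) ≃ₗ[ℝ] E b := by
  haveI := VectorBundle.finiteDimensional ℝ F E b
  exact (LinearMap.BilinForm.toDual _ (g.nondegenerate_toBilinForm b)).symm

/-- Defining property of `♯`: `g_b(♯α, w) = α w`. O'Neill 1983, Ch. 3, p. 60. [cite: ONeill1983, Ch. 3  p. 60] -/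
@[simp]
lemma val_sharp_apply (g : PseudoRiemannianMetric IB n F E) (b : B) (α : Module.Dual ℝ (E b))
    (w : E b) : g.val b (g.sharp b α) w = α w := by
  haveI := VectorBundle.finiteDimensional ℝ F E b
  exact LinearMap.BilinForm.apply_toDual_symm_apply (hB := g.nondegenerate_toBilinForm b) α w

/-- `♯ ∘ ♭ = id`. O'Neill 1983, Ch. 3, p. 60. [cite: ONeill1983, Ch. 3  p. 60] -/
@[simp]
lemma sharp_flat (g : PseudoRiemannianMetric IB n F E) (b : B) (v : E b) :
    g.sharp b (g.flat b v) = v :=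
  g.flat_injective b <| LinearMap.ext fun w ↦ by simp

/-- `♭ ∘ ♯ = id`. O'Neill 1983, Ch. 3, p. 60. [cite: ONeill1983, Ch. 3  p. 60] -/
@[simp]
lemma flat_sharp (g : PseudoRiemannianMetric IB n F E) (b : B) (α : Module.Dual ℝ (E b)) :
    g.flat b (g.sharp b α) = α :=
  LinearMap.ext fun w ↦ by simp

/-- **Metric trace** (contraction) of a bilinear form `T` on the fibre at `b`:
`tr_g T = g^{ij} T_{ij}`, defined as the trace of the endomorphism `♯ ∘ T : v ↦ ♯(T(v, ·))`
(index raising followed by the ordinary trace). For `T = g_b` this is `dim E b`.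
O'Neill 1983, Ch. 3, pp. 60–61 (metric contraction), Lemma 3.36. [cite: ONeill1983, Ch. 3  pp. 60–61 (metric contraction] -/
def trace (g : PseudoRiemannianMetric IB n F E) (b : B) (T : LinearMap.BilinForm ℝ (E b)) : ℝ :=
  LinearMap.trace ℝ (E b) ((g.sharp b).toLinearMap ∘ₗ T)

/-- **Metric square norm** of a bilinear form `T` on the fibre at `b`:
`|T|²_g = T_{ij} T^{ij} = g^{ik} g^{jl} T_{ij} T_{kl}`, defined as the trace of
`(♯ ∘ T) ∘ (♯ ∘ Tᵗ)` where `Tᵗ = T.flip`; for symmetric `T` this is `tr ((g⁻¹T)²)`. Not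
necessarily nonnegative for an indefinite metric. O'Neill 1983, Ch. 3, pp. 60–61. [cite: ONeill1983, Ch. 3  pp. 60–61] -/
def normSq (g : PseudoRiemannianMetric IB n F E) (b : B) (T : LinearMap.BilinForm ℝ (E b)) : ℝ :=
  LinearMap.trace ℝ (E b)
    (((g.sharp b).toLinearMap ∘ₗ T) ∘ₗ ((g.sharp b).toLinearMap ∘ₗ T.flip))

/-- The **inverse metric** on covectors at `b`: `g^{-1}(α, β) = g^{ij} α_i β_j = α (♯β)`
(equivalently `g_b(♯α, ♯β)`). O'Neill 1983, Ch. 3, p. 60. [cite: ONeill1983, Ch. 3  p. 60] -/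
def innerDual (g : PseudoRiemannianMetric IB n F E) (b : B) (α β : Module.Dual ℝ (E b)) : ℝ :=
  α (g.sharp b β)

/-- `g^{-1}(α, β) = g(♯α, ♯β)`. O'Neill 1983, Ch. 3, p. 60. [cite: ONeill1983, Ch. 3  p. 60] -/
lemma innerDual_eq_val_sharp_sharp (g : PseudoRiemannianMetric IB n F E) (b : B)
    (α β : Module.Dual ℝ (E b)) : g.innerDual b α β = g.val b (g.sharp b α) (g.sharp b β) := by
  simp [innerDual]

/-- The inverse metric is symmetric. O'Neill 1983, Ch. 3, p. 60. [cite: ONeill1983, Ch. 3  p. 60] -/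
lemma innerDual_comm (g : PseudoRiemannianMetric IB n F E) (b : B) (α β : Module.Dual ℝ (E b)) :
    g.innerDual b α β = g.innerDual b β α := by
  rw [innerDual_eq_val_sharp_sharp, innerDual_eq_val_sharp_sharp, g.symm]

/-- The metric trace of the metric itself is the fibre dimension: `g^{ij} g_{ij} = dim`.
O'Neill 1983, Ch. 3, Lemma 3.36. [cite: ONeill1983, Ch. 3  Lemma 3.36] -/
def trace_toBilinForm : Prop :=
  ∀ (g : PseudoRiemannianMetric IB n F E) (b : B),
    g.trace b (g.toBilinForm b) = Module.finrank ℝ F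

end FiniteDimensional

end PseudoRiemannianMetric

end Literature.Geometry.Lorentzian

end
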